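import Summits.AnomalousDissipation.AnomalousDissipation.Theorems.SoloBlindDriftScreening

/-!
# Swept steady states for every unidirectional force (solo soloist, blind mode)

`SoloBlindSweptStates` generalises the drifted Kolmogorov states of `SoloBlindDriftStates` /
`SoloBlindDriftScreening` from the single force `cos(2πx₃)e₁` to the whole class of
**unidirectional** trigonometric-polynomial forces and to an arbitrary conserved momentum.

**Setting.** A force `f = realTrigPoly S C` whose finitely many modes `S` lie on one line
`ℤk₀` (`k = n(k) • k₀` on `S`, `0 ∉ S`, `S = -S`), with real (`IsConjSymm C`) divergence-free
(`IsTransversal S C`) coefficients — i.e. `f(x) = F(k₀·x)` with a vector profile `F ⊥ k₀` of zero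
mean: every Kolmogorov-type shear force, with any direction, any polarisation and any number of
harmonics. A momentum (mean velocity) `c ∈ ℝ³`.

**The swept states.** With the **swept symbol** `σ_{ν,c}(k) = 4π²ν|k|² + 2πi (c·k)` (the
multiplier of `(c·∇) - νΔ`), the field
`U_{ν,c} = c + Re Σ_{k∈S} e_k σ_{ν,c}(k)⁻¹ f̂(k)` (`sweptState`)
is a smooth STEADY solution of `NS_ν(f)` with constant pressure whenever `σ ≠ 0` on `S`
(`isSteadyNSState_sweptState`). The point is that its nonlinearity is pure sweeping:
`(U·∇)U = (c·∇)U` (`convect_sweptState`), because the oscillatory part is a function of `k₀·x`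
taking values orthogonal to `k₀`. Energy, dissipation and momentum are explicit
(`integral_norm_sq_sweptState`, `dissipation_sweptState`, `integral_sweptState`):
`∫‖U‖² = ‖c‖² + Σ_{k∈S} ‖f̂(k)‖²/|σ(k)|²`, `ν‖∇U‖² = 4π²ν Σ_{k∈S} |k|²‖f̂(k)‖²/|σ(k)|²`, `∫U = c`.

**Non-resonant momentum screens the force at every viscosity.** If `c·k₀ ≠ 0` then
`|σ(k)|² ≥ 4π²(c·k₀)²` on `S` uniformly in `ν ≥ 0`, whence (`integral_norm_sq_sweptState_le`,
`dissipation_sweptState_le`)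
`∫‖U_{ν,c}‖² ≤ ‖c‖² + ‖f‖₂²/(4π²(c·k₀)²)` and `ν‖∇U_{ν,c}‖² ≤ ν · |k₀|²‖f‖₂²/(c·k₀)²`:
bounded energy uniformly in `ν` and dissipation `O(ν)`. Packaged in the vocabulary of the summit
(`exists_sweptFamily`): for EVERY such force and EVERY momentum `c` with `c·k₀ ≠ 0` there are
global Leray–Hopf solutions of `NS_{νⱼ}(f)`, `νⱼ = 1/(j+1)`, of momentum `c`, with mean energy
bounded uniformly in `j` and mean dissipation `≤ K νⱼ → 0` — every clause of
`Literature.Turb.ZerothLaw` except the dissipation floor, on every non-resonant momentum leaf,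
for the whole unidirectional class (the Kolmogorov case `k₀ = e₃`, `c = e₃` is
`exists_boundedEnergy_vanishingDissipation`).

**What it says about the summit.** The obstruction recorded for the Kolmogorov force is not an
accident of that force: for all shear-type forces, any a-priori argument producing the floor
`⟨ν|∇u|²⟩ ≥ ε` from bounded energy and the equations alone must fail, since its hypotheses are met
by these dissipationless exact solutions; a proof has to use the momentum constraint (`c·k₀ = 0`,
in particular zero momentum) or a selection principle excluding the swept branch.
[cite: Frisch1995, §5.2] [cite: DoeringFoias2002, §2]
-/

open MeasureTheory Filter Topology Set UnitAddTorus
open scoped ENNReal NNReal ComplexConjugate InnerProductSpace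

noncomputable section

namespace Summit.AnomalousDissipation.AnomalousDissipation.Theorems

open Literature.Analysis.FunctionSpaces Literature.Analysis.FunctionSpaces.Torus
open Literature.Analysis.FluidPDE

/-! ### The swept symbol and the swept coefficients -/

/-- The pairing `c·k = Σᵢ cᵢ kᵢ` of a momentum with an integer frequency. [folklore] -/
def freqDot (c : EuclideanSpace ℝ (Fin 3)) (k : Fin 3 → ℤ) : ℝ := ∑ i, c i * (k i : ℝ)

/-- `c·0 = 0`. [folklore] -/
theorem freqDot_zero (c : EuclideanSpace ℝ (Fin 3)) : freqDot c 0 = 0 := by simp [freqDot]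

/-- `c·(-k) = -(c·k)`. [folklore] -/
theorem freqDot_neg (c : EuclideanSpace ℝ (Fin 3)) (k : Fin 3 → ℤ) :
    freqDot c (-k) = -freqDot c k := by
  simp [freqDot, Finset.sum_neg_distrib, mul_neg]

/-- `c·(n k₀) = n (c·k₀)`. [folklore] -/
theorem freqDot_zsmul (c : EuclideanSpace ℝ (Fin 3)) (n : ℤ) (k₀ : Fin 3 → ℤ) :
    freqDot c (n • k₀) = n * freqDot c k₀ := by
  simp only [freqDot, Pi.smul_apply, smul_eq_mul, Int.cast_mul, Finset.mul_sum]
  exact Finset.sum_congr rfl fun i _ => by ring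

/-- `|n k₀|² = n² |k₀|²`. [folklore] -/
theorem freqNormSq_zsmul (n : ℤ) (k₀ : Fin 3 → ℤ) :
    freqNormSq (n • k₀) = (n : ℝ) ^ 2 * freqNormSq k₀ := by
  simp only [freqNormSq, Pi.smul_apply, smul_eq_mul, Int.cast_mul, Finset.mul_sum]
  exact Finset.sum_congr rfl fun i _ => by ring

/-- **The swept symbol** `σ_{ν,c}(k) = 4π²ν|k|² + 2πi (c·k)`: the Fourier multiplier of
`(c·∇) - νΔ`. [folklore] -/
def sweptSymbol (ν : ℝ) (c : EuclideanSpace ℝ (Fin 3)) (k : Fin 3 → ℤ) : ℂ :=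
  ⟨4 * Real.pi ^ 2 * ν * freqNormSq k, 2 * Real.pi * freqDot c k⟩

/-- The swept symbol as `re + im·i`. [folklore] -/
theorem sweptSymbol_eq (ν : ℝ) (c : EuclideanSpace ℝ (Fin 3)) (k : Fin 3 → ℤ) :
    sweptSymbol ν c k =
      ((4 * Real.pi ^ 2 * ν * freqNormSq k : ℝ) : ℂ) + ((2 * Real.pi * freqDot c k : ℝ) : ℂ) *
        Complex.I := by
  apply Complex.ext
  · simp only [sweptSymbol, Complex.add_re, Complex.mul_re, Complex.ofReal_re, Complex.ofReal_im,
      Complex.I_re, Complex.I_im, mul_zero, zero_mul, sub_zero, add_zero]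
  · simp only [sweptSymbol, Complex.add_im, Complex.mul_im, Complex.ofReal_re, Complex.ofReal_im,
      Complex.I_re, Complex.I_im, mul_one, mul_zero, add_zero, zero_add]

/-- `σ(-k) = conj σ(k)`. [folklore] -/
theorem sweptSymbol_neg (ν : ℝ) (c : EuclideanSpace ℝ (Fin 3)) (k : Fin 3 → ℤ) :
    sweptSymbol ν c (-k) = starRingEnd ℂ (sweptSymbol ν c k) := by
  apply Complex.ext
  · simp only [sweptSymbol, Complex.conj_re, freqNormSq_neg]
  · simp only [sweptSymbol, Complex.conj_im, freqDot_neg, mul_neg]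

/-- `|σ(k)|² = (4π²ν|k|²)² + (2π c·k)²`. [folklore] -/
theorem norm_sq_sweptSymbol (ν : ℝ) (c : EuclideanSpace ℝ (Fin 3)) (k : Fin 3 → ℤ) :
    ‖sweptSymbol ν c k‖ ^ 2 =
      (4 * Real.pi ^ 2 * ν * freqNormSq k) ^ 2 + (2 * Real.pi * freqDot c k) ^ 2 := by
  rw [Complex.sq_norm, Complex.normSq_apply]
  simp only [sweptSymbol]
  ring

/-- The swept symbol does not vanish at `k ≠ 0` if `ν ≠ 0`, and at any `k` with `c·k ≠ 0`.
[folklore] -/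
theorem sweptSymbol_ne_zero {ν : ℝ} {c : EuclideanSpace ℝ (Fin 3)} {k : Fin 3 → ℤ}
    (h : (ν ≠ 0 ∧ k ≠ 0) ∨ freqDot c k ≠ 0) : sweptSymbol ν c k ≠ 0 := by
  intro h0
  have hre := congrArg Complex.re h0
  have him := congrArg Complex.im h0
  simp only [sweptSymbol, Complex.zero_re, Complex.zero_im] at hre him
  rcases h with ⟨hν, hk⟩ | hck
  · have h4 : 4 * Real.pi ^ 2 ≠ 0 := by positivity
    exact mul_ne_zero (mul_ne_zero h4 hν)
      (lt_of_lt_of_le one_pos (one_le_freqNormSq_of_ne_zero hk)).ne' hre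
  · have h2 : 2 * Real.pi ≠ 0 := by positivity
    exact mul_ne_zero h2 hck him

/-- **Swept coefficients**: the momentum `c` at the zero mode, `σ(k)⁻¹ f̂(k)` elsewhere.
[folklore] -/
def sweptCoeff (ν : ℝ) (c : EuclideanSpace ℝ (Fin 3)) (C : (Fin 3 → ℤ) → EuclideanSpace ℂ (Fin 3))
    (k : Fin 3 → ℤ) : EuclideanSpace ℂ (Fin 3) :=
  if k = 0 then EuclideanSpace.complexify c else (sweptSymbol ν c k)⁻¹ • C k

/-- The zero mode of a swept state is the momentum. [folklore] -/
theorem sweptCoeff_zero (ν : ℝ) (c : EuclideanSpace ℝ (Fin 3))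
    (C : (Fin 3 → ℤ) → EuclideanSpace ℂ (Fin 3)) :
    sweptCoeff ν c C 0 = EuclideanSpace.complexify c := if_pos rfl

/-- Off the zero mode the coefficient is `σ⁻¹ f̂`. [folklore] -/
theorem sweptCoeff_of_ne_zero (ν : ℝ) (c : EuclideanSpace ℝ (Fin 3))
    (C : (Fin 3 → ℤ) → EuclideanSpace ℂ (Fin 3)) {k : Fin 3 → ℤ} (hk : k ≠ 0) :
    sweptCoeff ν c C k = (sweptSymbol ν c k)⁻¹ • C k := if_neg hk

/-- Swept coefficients of a real force are conjugate-symmetric (the state is real). [folklore] -/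
theorem isConjSymm_sweptCoeff (ν : ℝ) (c : EuclideanSpace ℝ (Fin 3))
    {C : (Fin 3 → ℤ) → EuclideanSpace ℂ (Fin 3)} (hC : IsConjSymm C) :
    IsConjSymm (sweptCoeff ν c C) := by
  intro k
  by_cases hk : k = 0
  · subst hk
    rw [neg_zero, sweptCoeff_zero, EuclideanSpace.conjVec_complexify]
  · rw [sweptCoeff_of_ne_zero ν c C (neg_ne_zero.2 hk), sweptCoeff_of_ne_zero ν c C hk,
      EuclideanSpace.conjVec_smul, hC k, sweptSymbol_neg, map_inv₀]

/-- Swept coefficients of a divergence-free force are transversal. [folklore] -/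
theorem isTransversal_sweptCoeff (ν : ℝ) (c : EuclideanSpace ℝ (Fin 3)) {S : Finset (Fin 3 → ℤ)}
    {C : (Fin 3 → ℤ) → EuclideanSpace ℂ (Fin 3)} (hT : IsTransversal S C) :
    IsTransversal (insert 0 S) (sweptCoeff ν c C) := by
  intro k hk
  by_cases hk0 : k = 0
  · subst hk0
    simp only [Pi.zero_apply, Int.cast_zero, zero_mul, Finset.sum_const_zero]
  · have hkS : k ∈ S := by simpa [hk0] using hk
    simp_rw [sweptCoeff_of_ne_zero ν c C hk0, PiLp.smul_apply, smul_eq_mul,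
      mul_left_comm _ ((sweptSymbol ν c k)⁻¹)]
    rw [← Finset.mul_sum, hT k hkS, mul_zero]

/-! ### The swept states -/

/-- **The swept state** `U_{ν,c} = c + Re Σ_{k∈S} e_k σ_{ν,c}(k)⁻¹ f̂(k)` of the force with
coefficients `C` on `S`, at momentum `c` and viscosity `ν`. [folklore] -/
def sweptState (ν : ℝ) (c : EuclideanSpace ℝ (Fin 3)) (S : Finset (Fin 3 → ℤ))
    (C : (Fin 3 → ℤ) → EuclideanSpace ℂ (Fin 3)) :
    UnitAddTorus (Fin 3) → EuclideanSpace ℝ (Fin 3) :=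
  realTrigPoly (insert 0 S) (sweptCoeff ν c C)

/-- Swept states are smooth. [folklore] -/
theorem isSmooth_sweptState (ν : ℝ) (c : EuclideanSpace ℝ (Fin 3)) (S : Finset (Fin 3 → ℤ))
    (C : (Fin 3 → ℤ) → EuclideanSpace ℂ (Fin 3)) : IsSmooth (sweptState ν c S C) :=
  isSmooth_realTrigPoly _ _

/-- Swept states of divergence-free forces are divergence free. [folklore] -/
theorem isDivFree_sweptState (ν : ℝ) (c : EuclideanSpace ℝ (Fin 3)) {S : Finset (Fin 3 → ℤ)}
    {C : (Fin 3 → ℤ) → EuclideanSpace ℂ (Fin 3)} (hT : IsTransversal S C) :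
    IsDivFree (sweptState ν c S C) :=
  isDivFree_realTrigPoly (isTransversal_sweptCoeff ν c hT)

/-- A force without zero mode, written on the enlarged mode set `insert 0 S`. [folklore] -/
theorem realTrigPoly_insert_zero {S : Finset (Fin 3 → ℤ)} (h0 : (0 : Fin 3 → ℤ) ∉ S)
    {C : (Fin 3 → ℤ) → EuclideanSpace ℂ (Fin 3)} (hC0 : C 0 = 0) (y : UnitAddTorus (Fin 3)) :
    realTrigPoly S C y = realTrigPoly (insert 0 S) C y := by
  rw [realTrigPoly_apply_eq_sum, realTrigPoly_apply_eq_sum, Finset.sum_insert h0, hC0, smul_zero,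
    map_zero, zero_add]

/-- **The oscillatory part of a swept state is orthogonal to the line of modes**:
`k₀ · U_{ν,c}(y) = k₀ · c` pointwise, when the modes lie on `ℤk₀` and the force is divergence
free. [folklore] -/
theorem freqDot_sweptState {ν : ℝ} {c : EuclideanSpace ℝ (Fin 3)} {S : Finset (Fin 3 → ℤ)}
    {C : (Fin 3 → ℤ) → EuclideanSpace ℂ (Fin 3)} {k₀ : Fin 3 → ℤ} {n : (Fin 3 → ℤ) → ℤ}
    (h0 : (0 : Fin 3 → ℤ) ∉ S) (hn : ∀ k ∈ S, k = n k • k₀) (hT : IsTransversal S C)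
    (y : UnitAddTorus (Fin 3)) :
    ∑ i, sweptState ν c S C y i * (k₀ i : ℝ) = freqDot c k₀ := by
  -- coefficient-wise: `Σᵢ k₀ᵢ Ĉ(k)ᵢ = 0` on `S` (transversality divided by `n k ≠ 0`)
  have hperp : ∀ k ∈ S, ∑ i, ((k₀ i : ℝ) : ℂ) * sweptCoeff ν c C k i = 0 := by
    intro k hk
    have hk0 : k ≠ 0 := fun h => h0 (h ▸ hk)
    have hnk : (n k : ℂ) ≠ 0 := by
      have : n k ≠ 0 := fun h => hk0 (by rw [hn k hk, h, zero_smul])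
      exact_mod_cast this
    have ht := hT k hk
    have hkj : ∀ j, ((k j : ℤ) : ℂ) = (n k : ℂ) * ((k₀ j : ℤ) : ℂ) := fun j => by
      conv_lhs => rw [hn k hk]
      simp only [Pi.smul_apply, smul_eq_mul, Int.cast_mul]
    simp_rw [hkj, mul_assoc, ← Finset.mul_sum] at ht
    have ht' : ∑ i, ((k₀ i : ℤ) : ℂ) * C k i = 0 := by
      rcases mul_eq_zero.1 ht with h | h
      · exact absurd h hnk
      · exact h
    simp_rw [sweptCoeff_of_ne_zero ν c C hk0, PiLp.smul_apply, smul_eq_mul,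
      mul_left_comm _ ((sweptSymbol ν c k)⁻¹), ← Finset.mul_sum]
    rw [show (∑ i, ((k₀ i : ℝ) : ℂ) * C k i) = ∑ i, ((k₀ i : ℤ) : ℂ) * C k i from
      Finset.sum_congr rfl fun i _ => by norm_cast, ht', mul_zero]
  -- pointwise: real part of `Σ_k e_k(y) Σᵢ k₀ᵢ W(k)ᵢ`
  have hre : ∀ i, sweptState ν c S C y i * (k₀ i : ℝ) =
      ((((k₀ i : ℝ) : ℂ)) * trigPoly (insert 0 S) (sweptCoeff ν c C) y i).re := fun i => by
    rw [sweptState, realTrigPoly_apply_coord, Complex.re_ofReal_mul, mul_comm]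
  simp_rw [hre, ← Complex.re_sum, trigPoly_apply_coord, Finset.mul_sum]
  rw [Finset.sum_comm]
  simp_rw [mul_left_comm _ (mFourier _ y), ← Finset.mul_sum]
  rw [Finset.sum_insert h0,
    Finset.sum_eq_zero (s := S)
      (f := fun k => mFourier k y * ∑ i, ((k₀ i : ℝ) : ℂ) * sweptCoeff ν c C k i)
      fun k hk => by rw [hperp k hk, mul_zero],
    add_zero, mFourier_zero, ContinuousMap.one_apply, one_mul]
  simp_rw [sweptCoeff_zero, EuclideanSpace.complexify_apply, ← Complex.ofReal_mul,
    ← Complex.ofReal_sum, Complex.ofReal_re, freqDot]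
  exact Finset.sum_congr rfl fun i _ => mul_comm _ _

/-- Coefficients of `(c·∇)U_{ν,c}`: `2πi (c·k) Û(k)`. [folklore] -/
def sweepCoeff (ν : ℝ) (c : EuclideanSpace ℝ (Fin 3)) (C : (Fin 3 → ℤ) → EuclideanSpace ℂ (Fin 3))
    (k : Fin 3 → ℤ) : EuclideanSpace ℂ (Fin 3) :=
  (2 * Real.pi * Complex.I * ((freqDot c k : ℝ) : ℂ)) • sweptCoeff ν c C k

/-- **The nonlinearity of a swept state is pure sweeping**: `(U·∇)U = (c·∇)U`, i.e. its
coefficients are `2πi (c·k) Û(k)` — the oscillatory part is a function of `k₀·x` with values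
orthogonal to `k₀`. [folklore] -/
theorem convect_sweptState {ν : ℝ} {c : EuclideanSpace ℝ (Fin 3)} {S : Finset (Fin 3 → ℤ)}
    {C : (Fin 3 → ℤ) → EuclideanSpace ℂ (Fin 3)} {k₀ : Fin 3 → ℤ} {n : (Fin 3 → ℤ) → ℤ}
    (h0 : (0 : Fin 3 → ℤ) ∉ S) (hn : ∀ k ∈ S, k = n k • k₀) (hT : IsTransversal S C)
    (y : UnitAddTorus (Fin 3)) :
    Torus.convect (sweptState ν c S C) (sweptState ν c S C) y =
      realTrigPoly (insert 0 S) (sweepCoeff ν c C) y := by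
  classical
  -- the harmonic index, extended by `0` at the zero mode
  obtain ⟨n', hn'0, hn'S⟩ : ∃ n' : (Fin 3 → ℤ) → ℤ, n' 0 = 0 ∧ ∀ k ∈ S, n' k = n k :=
    ⟨fun k => if k = 0 then 0 else n k, if_pos rfl,
      fun k hk => if_neg fun h : k = 0 => h0 (h ▸ hk)⟩
  have hk' : ∀ k ∈ insert (0 : Fin 3 → ℤ) S, ∀ i, (k i : ℝ) = (n' k : ℝ) * (k₀ i : ℝ) := by
    intro k hk i
    by_cases hk0 : k = 0
    · subst hk0; simp [hn'0]
    · have hkS : k ∈ S := by simpa [hk0] using hk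
      rw [hn'S k hkS]
      conv_lhs => rw [hn k hkS]
      simp only [Pi.smul_apply, smul_eq_mul, Int.cast_mul]
  have hdot : ∀ k ∈ insert (0 : Fin 3 → ℤ) S, freqDot c k = (n' k : ℝ) * freqDot c k₀ := by
    intro k hk
    simp only [freqDot, Finset.mul_sum]
    exact Finset.sum_congr rfl fun i _ => by rw [hk' k hk i]; ring
  -- the common profile derivative `D(k) = 2πi n'(k) Û(k)`: `∂ᵢU = (k₀)ᵢ · realTrigPoly D`
  have h1 : IsContDiff 1 (sweptState ν c S C) := (isSmooth_sweptState ν c S C).isContDiff (by simp)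
  have hpd : ∀ i, partialDeriv i (sweptState ν c S C) y =
      (k₀ i : ℝ) • realTrigPoly (insert 0 S)
        (fun k => (2 * Real.pi * Complex.I * ((n' k : ℝ) : ℂ)) • sweptCoeff ν c C k) y :=
      fun i => by
    rw [sweptState, partialDeriv_realTrigPoly, smul_realTrigPoly_apply]
    refine congrFun (realTrigPoly_congr fun k hk => ?_) y
    rw [Pi.smul_apply, ← Complex.coe_smul, smul_smul]
    congr 1
    have h' : ((k i : ℤ) : ℂ) = ((n' k : ℝ) : ℂ) * ((k₀ i : ℝ) : ℂ) := by
      rw [← Complex.ofReal_intCast, hk' k hk i, Complex.ofReal_mul]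
    rw [h']
    ring
  rw [Torus.convect, fderiv_apply_eq_sum_partialDeriv h1]
  simp_rw [hpd, smul_smul, ← Finset.sum_smul]
  rw [freqDot_sweptState h0 hn hT y, smul_realTrigPoly_apply]
  refine congrFun (realTrigPoly_congr fun k hk => ?_) y
  rw [Pi.smul_apply, sweepCoeff, ← Complex.coe_smul, smul_smul, hdot k hk]
  push_cast
  ring_nf

/-- Coefficients of `Δ U_{ν,c}`. [folklore] -/
def sweptLapCoeff (ν : ℝ) (c : EuclideanSpace ℝ (Fin 3))
    (C : (Fin 3 → ℤ) → EuclideanSpace ℂ (Fin 3)) (k : Fin 3 → ℤ) : EuclideanSpace ℂ (Fin 3) :=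
  -(((4 * Real.pi ^ 2 * freqNormSq k : ℝ) : ℂ) • sweptCoeff ν c C k)

/-- **The coefficient balance** `(c·∇)U = νΔU + f` mode by mode: `σ(k) σ(k)⁻¹ f̂(k) = f̂(k)`.
[folklore] -/
theorem sweptCoeff_balance {ν : ℝ} {c : EuclideanSpace ℝ (Fin 3)} {S : Finset (Fin 3 → ℤ)}
    {C : (Fin 3 → ℤ) → EuclideanSpace ℂ (Fin 3)} (hC0 : C 0 = 0)
    (hσ : ∀ k ∈ S, sweptSymbol ν c k ≠ 0) :
    ∀ k ∈ insert (0 : Fin 3 → ℤ) S,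
      sweepCoeff ν c C k = ν • sweptLapCoeff ν c C k + C k := by
  intro k hk
  by_cases hk0 : k = 0
  · subst hk0
    simp [sweepCoeff, sweptLapCoeff, freqDot_zero, freqNormSq_zero, hC0]
  · have hkS : k ∈ S := by simpa [hk0] using hk
    have hinv : sweptSymbol ν c k * (sweptSymbol ν c k)⁻¹ = 1 := mul_inv_cancel₀ (hσ k hkS)
    have hdef := sweptSymbol_eq ν c k
    rw [sweepCoeff, sweptLapCoeff, sweptCoeff_of_ne_zero ν c C hk0, ← Complex.coe_smul, smul_smul,
      smul_neg, smul_smul, ← neg_smul, smul_smul,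
      show ∀ z : ℂ, z • C k + C k = (z + 1) • C k from fun z => by rw [add_smul, one_smul]]
    congr 1
    push_cast at hdef ⊢
    linear_combination (-(sweptSymbol ν c k)⁻¹) * hdef + hinv

/-- **Swept states are steady Navier–Stokes states** of `NS_ν(f)` with constant pressure, for
every unidirectional divergence-free trigonometric-polynomial force `f = realTrigPoly S C` and
every momentum `c`, as soon as the swept symbol does not vanish on `S` (`ν ≠ 0`, or `c·k ≠ 0` on
`S`); at `ν = 0` they are smooth steady forced Euler flows doing no work. [folklore] -/
theorem isSteadyNSState_sweptState {ν : ℝ} {c : EuclideanSpace ℝ (Fin 3)} {S : Finset (Fin 3 → ℤ)}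
    {C : (Fin 3 → ℤ) → EuclideanSpace ℂ (Fin 3)} {k₀ : Fin 3 → ℤ} {n : (Fin 3 → ℤ) → ℤ}
    (h0 : (0 : Fin 3 → ℤ) ∉ S) (hn : ∀ k ∈ S, k = n k • k₀) (hT : IsTransversal S C)
    (hC0 : C 0 = 0) (hσ : ∀ k ∈ S, sweptSymbol ν c k ≠ 0) :
    Torus.IsSteadyNSState ν (realTrigPoly S C) (sweptState ν c S C) (fun _ => 0) := by
  refine ⟨isSmoothSpaceTimeOn_const (isSmooth_sweptState ν c S C) _,
    isSmoothSpaceTimeOn_const (isSmooth_const (0 : ℝ)) _, fun t _ y => ?_,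
    fun _ _ => isDivFree_sweptState ν c hT⟩
  have ht : Torus.timeDerivWithin Set.univ (fun _ : ℝ => sweptState ν c S C) t y = 0 := by
    simp [Torus.timeDerivWithin]
  have hg : Torus.gradient (fun _ : UnitAddTorus (Fin 3) => (0 : ℝ)) y = 0 := by
    unfold Torus.gradient Torus.liftAt
    simp [_root_.gradient]
  have hlap : Torus.laplacian (sweptState ν c S C) y =
      realTrigPoly (insert 0 S) (sweptLapCoeff ν c C) y := laplacian_realTrigPoly _ _ y
  rw [ht, zero_add, hg, sub_zero, convect_sweptState h0 hn hT, hlap,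
    realTrigPoly_insert_zero h0 hC0, smul_realTrigPoly_apply]
  have hfun : realTrigPoly (insert 0 S) (sweepCoeff ν c C) =
      realTrigPoly (insert 0 S) (ν • sweptLapCoeff ν c C + C) :=
    realTrigPoly_congr fun k hk => by
      simpa only [Pi.smul_apply, Pi.add_apply] using sweptCoeff_balance hC0 hσ k hk
  rw [hfun, realTrigPoly_add]
  rfl

end Summit.AnomalousDissipation.AnomalousDissipation.Theorems

end
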